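import Summits.QuantumFields.YangMills.Theorems.PoincareLipschitzAxialStationarity
import Literature.Analysis.FunctionSpaces.WeakDerivInner
import Literature.Analysis.FunctionSpaces.SobolevTraceDensityProofs
import Literature.Analysis.FluidPDE.CKNPressureHessianSlice
import Summits.QuantumFields.YangMills.Theorems.PoincareLipschitzMinimiserWeaklyHarmonicLetters
import Mathlib.Analysis.InnerProductSpace.LinearMap
import HarnessLib

/-!
# Crux `BlockLipschitzL` (stmt-QuantumFields-23533) ∕ `HistoryTailL` (stmt-QuantumFields-19936), LINE 25 «CompactnessTransfer»,
# K2 continuum face, row (RS) `MinimisingMapSmoothness` — FILE (RS-0) «BALL MINIMISERS INTO A SPHERE ARE WEAKLY HARMONIC»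

Cell `ym3-torus` (YM ladder rung R3 = continuum SU(2) Yang–Mills on T³ — a RUNG, NOT the Clay problem: not d = 4, not
infinite volume, not a mass gap); WIDTH helper seat `ym-ust-19936-w7` g14.  Helper `--supports stmt-QuantumFields-23533`;
THEOREMS ONLY (0 `def`, 0 `sorry`, default heartbeats).  Imports: w2 g13's FILE γ ✓`PoincareLipschitzAxialStationarity`
(for its letters and the elementary ✓`eq_zero_of_quadratic_nonneg`), lit ✓`WeakDerivInner` (`HasWeakFDerivOn.smul_contDiff`),
lit ✓`SobolevTraceDensityProofs` (`SobolevApprox.hasWeakFDerivOn_add`), lit ✓`CKNPressureHessianSlice` (`HasWeakFDerivOn.clm_comp`),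
and this file's letters ✓`PoincareLipschitzMinimiserWeaklyHarmonicLetters` (the plane rotation `R(θ)`: isometry, `R′ = RJ`, angle calculus).

THE OBJECT.  `U` weakly differentiable on an open `Ω ⊆ ℝ³` with weak gradient `G` (lit `HasWeakFDerivOn Ω volume U G`),
UNIT on `Ω` (values in the unit sphere of a real inner-product space `F`; for the vended facts `F = ℝ⁴`, sphere `S³`), of
finite energy `∫_Ω Σ_i ‖G e_i‖²`, and energy minimising on a ball `B_ρ(y) ⊆ Ω` among finite-energy unit `W^{1,2}(Ω)`
competitors agreeing with `U` off some `B_{ρ″}(y)`, `ρ″ < ρ` — the minimality notion of [Simon1996, §2.1] in Sobolev phrasing,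
i.e. the `hmin` row of w2 g13's ✓`axial_stationarity` VERBATIM and the hypothesis block of lit
`Literature.Analysis.PDE.MinimisingMapSmoothness` ∕ `…Compactness` (§2 below takes that block verbatim).

WHAT THIS FILE PROVES.  The FIRST OUTER VARIATION vanishes: for every pair of orthonormal vectors `p, q ∈ F` and every
`ζ ∈ C^∞` with `tsupport ζ ⊆ B_{ρ′}(y)`, `ρ′ < ρ`,
`∫_{B_ρ(y)} Σ_i ∂_iζ · ( ⟪p, U⟫·⟪G e_i, q⟫ − ⟪q, U⟫·⟪G e_i, p⟫ ) = 0`   (★★★ `weaklyHarmonic`),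
the weak form of the conservation law `div( U^p ∇U^q − U^q ∇U^p ) = 0` — for sphere targets this family (all `p ⊥ q`) IS the
harmonic-map equation `−ΔU = |∇U|² U` in divergence form ([Helein2002] §1.4; [Simon1996] §2.2 (ii); [SchoenUhlenbeck1982]
§2), ★★ `exists_rotated_competitor` being the admissible comparison map.  With w2 g13's INNER first variation (✓`axial_stationarity`: ball minimisers are STATIONARY) the tree now holds both
first-variation facts from which every regularity road for (RS) starts (Schoen–Uhlenbeck ε-regularity; Hélein's div–curl
route for sphere targets).  §2 restates the theorem on the open unit cube with the hypothesis block of the vended facts.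

PROOF WITHOUT LIMITS (w2's FILE γ pattern, outer instead of inner variation).  The competitor is the ROTATED map
`W_t(x) := R(t·ζ(x)) (U x)`, `R(θ) := 1 + sin θ·J + (cos θ − 1)·P`, `J z := ⟪p,z⟫q − ⟪q,z⟫p`, `P z := ⟪p,z⟫p + ⟪q,z⟫q`
(the rotation by `θ` in the `(p,q)`-plane, the identity on its orthocomplement — an ISOMETRY of `F`, letters file): it is unit on
`Ω`, equals `U` wherever `ζ = 0` (at EVERY point, also off `Ω`), is Sobolev on `Ω` by the product rule, and its energy
density is EXACTLY QUADRATIC in `t`: `Σ_i ‖G_W e_i‖² = Σ_i ‖G e_i + t·∂_iζ·J U‖²` (letters ★ `norm_rot_deriv_sq`: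
`G_W e_i = R(tζ)(G e_i + t∂_iζ·JU)` and `R` is norm preserving).  Minimality for both signs of `t` and ✓`eq_zero_of_quadratic_nonneg`
kill the `t`-coefficient `2·∫ Σ_i ∂_iζ ⟪G e_i, J U⟫`.

HONEST SCOPE.  One first-variation identity for Sobolev maps; nothing of (RS) `MinimisingMapSmoothness`, (C)
`MinimisingMapCompactness`, S1″, `hHalvingBand`, K1, `MeanDeviationL`, `BlockLipschitzL`, `HistoryTailL` is proved here.
YM₃ on T³ is rung R3, not Clay; YM gap NOT proved; no summit statement is proved here.

References: F. Hélein, Harmonic Maps, Conservation Laws and Moving Frames, 2nd ed., CUP (2002) [Helein2002] (§1.4, the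
conservation laws of sphere-valued harmonic maps); L. Simon, Theorems on Regularity and Singularity of Energy Minimizing
Maps (1996) [Simon1996] (§2.2 (ii): minimisers are weakly harmonic); R. Schoen, K. Uhlenbeck, J. Differential Geom. 17
(1982) 307–335 [SchoenUhlenbeck1982] (§2); R. Schoen, K. Uhlenbeck, Invent. Math. 78 (1984) 89–100 [SchoenUhlenbeck1984].
-/

set_option autoImplicit false

noncomputable section

open MeasureTheory Set Function Filter Topology Metric TopologicalSpace
open scoped ContDiff RealInnerProductSpace BigOperators

namespace Summit.QuantumFields.YangMills.Theorems.PoincareLipschitzMinimiserWeaklyHarmonic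

open Literature.Analysis.FunctionSpaces (IsTestFunctionOn HasWeakFDerivOn)
open Literature.Analysis.FunctionSpaces.SobolevApprox (hasWeakFDerivOn_add)
open Summit.QuantumFields.YangMills.Theorems.PoincareLipschitzAxialStationarity (eq_zero_of_quadratic_nonneg)
open Summit.QuantumFields.YangMills.Theorems.PoincareLipschitzAxialStationarityLetters
open Summit.QuantumFields.YangMills.Theorems.PoincareLipschitzMinimiserWeaklyHarmonicLetters

variable {F : Type*} [NormedAddCommGroup F] [InnerProductSpace ℝ F]

/-! ## §1 The rotated competitor and the first outer variation of a ball minimiser -/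

/-- **The cross term `∂_iζ · ⟪G e_i, J U⟫` is integrable on `Ω`** (`|∂_iζ|·‖G e_i‖ ≤ (M∕2)‖G e_i‖² + |∂_iζ|∕2` with
`‖JU‖ ≤ 1` on `Ω`, `|∂_iζ| ≤ M`, `∂_iζ` compactly supported). [folklore] -/
theorem integrableOn_cross_term {Ω : Opens (EuclideanSpace ℝ (Fin 3))}
    {U : EuclideanSpace ℝ (Fin 3) → F} {G : EuclideanSpace ℝ (Fin 3) → EuclideanSpace ℝ (Fin 3) →L[ℝ] F}
    (hU : HasWeakFDerivOn Ω volume U G) (hU1 : ∀ x ∈ (Ω : Set (EuclideanSpace ℝ (Fin 3))), ‖U x‖ = 1)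
    (hGi : IntegrableOn (fun x => ∑ i : Fin 3, ‖G x (EuclideanSpace.single i (1:ℝ))‖ ^ 2) (Ω : Set _) volume)
    {p q : F} (hp : ‖p‖ = 1) (hq : ‖q‖ = 1) (hpq : ⟪p, q⟫ = 0)
    {J : F →L[ℝ] F} (hJ : ∀ z, J z = ⟪p, z⟫ • q - ⟪q, z⟫ • p)
    {ζ : EuclideanSpace ℝ (Fin 3) → ℝ} (hζ : ContDiff ℝ ∞ ζ) (hζc : HasCompactSupport ζ) (i : Fin 3) :
    IntegrableOn (fun x => fderiv ℝ ζ x (EuclideanSpace.single i (1:ℝ)) *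
      ⟪G x (EuclideanSpace.single i (1:ℝ)), J (U x)⟫) (Ω : Set _) volume := by
  have hζ'c : Continuous (fderiv ℝ ζ) := hζ.continuous_fderiv (by simp)
  have hGm : AEStronglyMeasurable G (volume.restrict (Ω : Set _)) := hU.locallyIntegrableOn_deriv.aestronglyMeasurable
  have hUm : AEStronglyMeasurable U (volume.restrict (Ω : Set _)) := hU.locallyIntegrableOn.aestronglyMeasurable
  have hJUm : AEStronglyMeasurable (fun x => J (U x)) (volume.restrict (Ω : Set _)) :=
    J.continuous.comp_aestronglyMeasurable hUm
  have hGim : AEStronglyMeasurable (fun x => G x (EuclideanSpace.single i (1:ℝ))) (volume.restrict (Ω : Set _)) :=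
    (ContinuousLinearMap.apply ℝ F (EuclideanSpace.single i (1:ℝ))).continuous.comp_aestronglyMeasurable hGm
  have Isq : IntegrableOn (fun x => ‖G x (EuclideanSpace.single i (1:ℝ))‖ ^ 2) (Ω : Set _) volume :=
    integrableOn_norm_sq_apply hGm hGi i
  have hJU1 : ∀ x ∈ (Ω : Set (EuclideanSpace ℝ (Fin 3))), ‖J (U x)‖ ≤ 1 := fun x hx =>
    (norm_J_le hp hq hpq hJ (U x)).trans (hU1 x hx).le
  obtain ⟨M, hM⟩ := (hζc.fderiv (𝕜 := ℝ)).exists_bound_of_continuous hζ'c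
  have ha_cont : Continuous fun x => fderiv ℝ ζ x (EuclideanSpace.single i (1:ℝ)) := hζ'c.clm_apply continuous_const
  have ha_cs : HasCompactSupport fun x => fderiv ℝ ζ x (EuclideanSpace.single i (1:ℝ)) :=
    hζc.fderiv_apply (𝕜 := ℝ) (EuclideanSpace.single i (1:ℝ))
  have ha_bd : ∀ x, |fderiv ℝ ζ x (EuclideanSpace.single i (1:ℝ))| ≤ M := fun x => abs_apply_single_le (hM x) i
  have hdom : IntegrableOn (fun x => M / 2 * ‖G x (EuclideanSpace.single i (1:ℝ))‖ ^ 2 +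
      ‖fderiv ℝ ζ x (EuclideanSpace.single i (1:ℝ))‖ / 2) (Ω : Set _) volume :=
    (Isq.const_mul _).add ((ha_cont.norm.integrable_of_hasCompactSupport ha_cs.norm).integrableOn.div_const _)
  refine Integrable.mono' hdom (ha_cont.aestronglyMeasurable.mul (hGim.inner hJUm)) ?_
  filter_upwards [ae_restrict_mem Ω.isOpen.measurableSet] with x hx
  simp only [norm_mul, Real.norm_eq_abs]
  have h1 := abs_real_inner_le_norm (G x (EuclideanSpace.single i (1:ℝ))) (J (U x))
  have h2 := hJU1 x hx
  have h3 := ha_bd x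
  have hg0 := norm_nonneg (G x (EuclideanSpace.single i (1:ℝ)))
  have ha0 := abs_nonneg (fderiv ℝ ζ x (EuclideanSpace.single i (1:ℝ)))
  have h4 : |⟪G x (EuclideanSpace.single i (1:ℝ)), J (U x)⟫| ≤ ‖G x (EuclideanSpace.single i (1:ℝ))‖ := by
    nlinarith [norm_nonneg (J (U x))]
  nlinarith [sq_nonneg (‖G x (EuclideanSpace.single i (1:ℝ))‖ - 1), mul_le_mul_of_nonneg_left h4 ha0]

/-- **The quadratic term `(∂_iζ)² · ‖J U‖²` is integrable on `Ω`** (`≤ (∂_iζ)²` on `Ω`, compactly supported). [folklore] -/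
theorem integrableOn_quad_term {Ω : Opens (EuclideanSpace ℝ (Fin 3))}
    {U : EuclideanSpace ℝ (Fin 3) → F} {G : EuclideanSpace ℝ (Fin 3) → EuclideanSpace ℝ (Fin 3) →L[ℝ] F}
    (hU : HasWeakFDerivOn Ω volume U G) (hU1 : ∀ x ∈ (Ω : Set (EuclideanSpace ℝ (Fin 3))), ‖U x‖ = 1)
    {p q : F} (hp : ‖p‖ = 1) (hq : ‖q‖ = 1) (hpq : ⟪p, q⟫ = 0)
    {J : F →L[ℝ] F} (hJ : ∀ z, J z = ⟪p, z⟫ • q - ⟪q, z⟫ • p)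
    {ζ : EuclideanSpace ℝ (Fin 3) → ℝ} (hζ : ContDiff ℝ ∞ ζ) (hζc : HasCompactSupport ζ) (i : Fin 3) :
    IntegrableOn (fun x => fderiv ℝ ζ x (EuclideanSpace.single i (1:ℝ)) ^ 2 * ‖J (U x)‖ ^ 2) (Ω : Set _) volume := by
  have hζ'c : Continuous (fderiv ℝ ζ) := hζ.continuous_fderiv (by simp)
  have hUm : AEStronglyMeasurable U (volume.restrict (Ω : Set _)) := hU.locallyIntegrableOn.aestronglyMeasurable
  have hJUm : AEStronglyMeasurable (fun x => J (U x)) (volume.restrict (Ω : Set _)) :=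
    J.continuous.comp_aestronglyMeasurable hUm
  have hJU1 : ∀ x ∈ (Ω : Set (EuclideanSpace ℝ (Fin 3))), ‖J (U x)‖ ≤ 1 := fun x hx =>
    (norm_J_le hp hq hpq hJ (U x)).trans (hU1 x hx).le
  have ha_cont : Continuous fun x => fderiv ℝ ζ x (EuclideanSpace.single i (1:ℝ)) := hζ'c.clm_apply continuous_const
  have ha_cs : HasCompactSupport fun x => fderiv ℝ ζ x (EuclideanSpace.single i (1:ℝ)) :=
    hζc.fderiv_apply (𝕜 := ℝ) (EuclideanSpace.single i (1:ℝ))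
  have hdom : IntegrableOn (fun x => fderiv ℝ ζ x (EuclideanSpace.single i (1:ℝ)) *
      fderiv ℝ ζ x (EuclideanSpace.single i (1:ℝ))) (Ω : Set _) volume :=
    ((ha_cont.mul ha_cont).integrable_of_hasCompactSupport ha_cs.mul_left).integrableOn
  refine Integrable.mono' hdom ((ha_cont.pow 2).aestronglyMeasurable.mul (hJUm.norm.pow 2)) ?_
  filter_upwards [ae_restrict_mem Ω.isOpen.measurableSet] with x hx
  rw [Real.norm_eq_abs, abs_mul, abs_of_nonneg (sq_nonneg _), abs_of_nonneg (sq_nonneg _)]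
  have h2 := hJU1 x hx
  have : ‖J (U x)‖ ^ 2 ≤ 1 := by nlinarith [norm_nonneg (J (U x))]
  nlinarith [sq_nonneg (fderiv ℝ ζ x (EuclideanSpace.single i (1:ℝ)))]

variable [CompleteSpace F]

/-- ★★ **THE ROTATED COMPETITOR.**  Data: `U` weakly differentiable on the open `Ω ⊆ ℝ³` with weak gradient `G`, unit on
`Ω`, of finite energy on `Ω`; an orthonormal pair `p, q ∈ F` with plane maps `J, P`; `ζ ∈ C^∞` with compact support
(anywhere — the rotation needs no localisation); `t ∈ ℝ`.  Then the rotated map `W = U + sin(tζ)•J U + (cos(tζ) − 1)•P U` has a weak gradient `GW` on `Ω`, is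
unit on `Ω`, equals `U` wherever `ζ = 0`, and its energy density is EXACTLY
`Σ_i ‖GW e_i‖² = Σ_i ‖G e_i‖² + t·(2 Σ_i ∂_iζ ⟪G e_i, J U⟫) + t²·Σ_i (∂_iζ)² ‖J U‖²` at every point; the density is
integrable on `Ω`. [cite: Helein2002, §1.4; Simon1996, §2.2 (ii)] -/
theorem exists_rotated_competitor {Ω : Opens (EuclideanSpace ℝ (Fin 3))}
    {U : EuclideanSpace ℝ (Fin 3) → F} {G : EuclideanSpace ℝ (Fin 3) → EuclideanSpace ℝ (Fin 3) →L[ℝ] F}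
    (hU : HasWeakFDerivOn Ω volume U G) (hU1 : ∀ x ∈ (Ω : Set (EuclideanSpace ℝ (Fin 3))), ‖U x‖ = 1)
    (hGi : IntegrableOn (fun x => ∑ i : Fin 3, ‖G x (EuclideanSpace.single i (1:ℝ))‖ ^ 2) (Ω : Set _) volume)
    {p q : F} (hp : ‖p‖ = 1) (hq : ‖q‖ = 1) (hpq : ⟪p, q⟫ = 0)
    {J P : F →L[ℝ] F} (hJ : ∀ z, J z = ⟪p, z⟫ • q - ⟪q, z⟫ • p) (hP : ∀ z, P z = ⟪p, z⟫ • p + ⟪q, z⟫ • q)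
    {ζ : EuclideanSpace ℝ (Fin 3) → ℝ} (hζ : ContDiff ℝ ∞ ζ) (hζc : HasCompactSupport ζ) (t : ℝ) :
    ∃ (W : EuclideanSpace ℝ (Fin 3) → F) (GW : EuclideanSpace ℝ (Fin 3) → EuclideanSpace ℝ (Fin 3) →L[ℝ] F),
      HasWeakFDerivOn Ω volume W GW ∧ (∀ x ∈ (Ω : Set (EuclideanSpace ℝ (Fin 3))), ‖W x‖ = 1) ∧
      IntegrableOn (fun x => ∑ i : Fin 3, ‖GW x (EuclideanSpace.single i (1:ℝ))‖ ^ 2) (Ω : Set _) volume ∧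
      (∀ x, ζ x = 0 → W x = U x) ∧
      ∀ x, ∑ i : Fin 3, ‖GW x (EuclideanSpace.single i (1:ℝ))‖ ^ 2 =
        (∑ i : Fin 3, ‖G x (EuclideanSpace.single i (1:ℝ))‖ ^ 2) +
        t * (2 * ∑ i : Fin 3, fderiv ℝ ζ x (EuclideanSpace.single i (1:ℝ)) *
          ⟪G x (EuclideanSpace.single i (1:ℝ)), J (U x)⟫) +
        t ^ 2 * ∑ i : Fin 3, fderiv ℝ ζ x (EuclideanSpace.single i (1:ℝ)) ^ 2 * ‖J (U x)‖ ^ 2 := by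
  -- the two angle functions
  have hζd : Differentiable ℝ ζ := hζ.differentiable (by simp)
  have hζ'c : Continuous (fderiv ℝ ζ) := hζ.continuous_fderiv (by simp)
  have hθ₁ : ContDiff ℝ ∞ (fun x => Real.sin (t * ζ x)) := Real.contDiff_sin.comp (contDiff_const.mul hζ)
  have hθ₂ : ContDiff ℝ ∞ (fun x => Real.cos (t * ζ x) - 1) :=
    (Real.contDiff_cos.comp (contDiff_const.mul hζ)).sub contDiff_const
  -- the Sobolev pieces
  have h1 := (hU.clm_comp J).smul_contDiff hθ₁
  have h2 := (hU.clm_comp P).smul_contDiff hθ₂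
  have hW : HasWeakFDerivOn Ω volume
      (fun x => U x + Real.sin (t * ζ x) • J (U x) + (Real.cos (t * ζ x) - 1) • P (U x))
      (fun x => G x + ((fderiv ℝ (fun x => Real.sin (t * ζ x)) x).smulRight (J (U x)) + Real.sin (t * ζ x) • J.comp (G x)) +
        ((fderiv ℝ (fun x => Real.cos (t * ζ x) - 1) x).smulRight (P (U x)) + (Real.cos (t * ζ x) - 1) • P.comp (G x))) :=
    hasWeakFDerivOn_add (hasWeakFDerivOn_add hU h1) h2
  -- unit on `Ω`
  have hunit : ∀ x ∈ (Ω : Set (EuclideanSpace ℝ (Fin 3))),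
      ‖U x + Real.sin (t * ζ x) • J (U x) + (Real.cos (t * ζ x) - 1) • P (U x)‖ = 1 := by
    intro x hx
    have h := norm_rot_sq hp hq hpq hJ hP (t * ζ x) (U x)
    rw [hU1 x hx, one_pow] at h
    exact (pow_eq_one_iff_of_nonneg (norm_nonneg _) two_ne_zero).1 h
  -- equals `U` where `ζ = 0`
  have hzero : ∀ x, ζ x = 0 → U x + Real.sin (t * ζ x) • J (U x) + (Real.cos (t * ζ x) - 1) • P (U x) = U x := by
    intro x hx
    simp only [hx, mul_zero, Real.sin_zero, Real.cos_zero, sub_self, zero_smul, add_zero]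
  -- the exact quadratic density
  have hdens : ∀ x, ∑ i : Fin 3, ‖(G x + ((fderiv ℝ (fun x => Real.sin (t * ζ x)) x).smulRight (J (U x)) +
        Real.sin (t * ζ x) • J.comp (G x)) +
        ((fderiv ℝ (fun x => Real.cos (t * ζ x) - 1) x).smulRight (P (U x)) + (Real.cos (t * ζ x) - 1) • P.comp (G x)))
          (EuclideanSpace.single i (1:ℝ))‖ ^ 2 =
      (∑ i : Fin 3, ‖G x (EuclideanSpace.single i (1:ℝ))‖ ^ 2) +
      t * (2 * ∑ i : Fin 3, fderiv ℝ ζ x (EuclideanSpace.single i (1:ℝ)) *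
        ⟪G x (EuclideanSpace.single i (1:ℝ)), J (U x)⟫) +
      t ^ 2 * ∑ i : Fin 3, fderiv ℝ ζ x (EuclideanSpace.single i (1:ℝ)) ^ 2 * ‖J (U x)‖ ^ 2 := by
    intro x
    have hterm : ∀ i : Fin 3, ‖(G x + ((fderiv ℝ (fun x => Real.sin (t * ζ x)) x).smulRight (J (U x)) +
        Real.sin (t * ζ x) • J.comp (G x)) +
        ((fderiv ℝ (fun x => Real.cos (t * ζ x) - 1) x).smulRight (P (U x)) + (Real.cos (t * ζ x) - 1) • P.comp (G x)))
          (EuclideanSpace.single i (1:ℝ))‖ ^ 2 =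
        ‖G x (EuclideanSpace.single i (1:ℝ))‖ ^ 2 +
        2 * (t * fderiv ℝ ζ x (EuclideanSpace.single i (1:ℝ))) * ⟪G x (EuclideanSpace.single i (1:ℝ)), J (U x)⟫ +
        (t * fderiv ℝ ζ x (EuclideanSpace.single i (1:ℝ))) ^ 2 * ‖J (U x)‖ ^ 2 := by
      intro i
      have hGW : (G x + ((fderiv ℝ (fun x => Real.sin (t * ζ x)) x).smulRight (J (U x)) +
          Real.sin (t * ζ x) • J.comp (G x)) +
          ((fderiv ℝ (fun x => Real.cos (t * ζ x) - 1) x).smulRight (P (U x)) + (Real.cos (t * ζ x) - 1) • P.comp (G x)))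
            (EuclideanSpace.single i (1:ℝ)) =
          (G x (EuclideanSpace.single i (1:ℝ)) + Real.sin (t * ζ x) • J (G x (EuclideanSpace.single i (1:ℝ))) +
            (Real.cos (t * ζ x) - 1) • P (G x (EuclideanSpace.single i (1:ℝ)))) +
          (t * fderiv ℝ ζ x (EuclideanSpace.single i (1:ℝ))) •
            (Real.cos (t * ζ x) • J (U x) - Real.sin (t * ζ x) • P (U x)) := by
        simp only [add_apply, smul_apply, ContinuousLinearMap.smulRight_apply, ContinuousLinearMap.comp_apply,
          fderiv_sin_const_mul hζd, fderiv_cos_const_mul_sub_one hζd]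
        module
      rw [hGW, norm_rot_deriv_sq hp hq hpq hJ hP, norm_add_smul_sq]
    rw [Finset.sum_congr rfl fun i _ => hterm i]
    simp only [Fin.sum_univ_three]
    ring
  -- integrability of the density on `Ω`
  have I1 := fun i : Fin 3 => integrableOn_cross_term hU hU1 hGi hp hq hpq hJ hζ hζc i
  have I2 := fun i : Fin 3 => integrableOn_quad_term hU hU1 hp hq hpq hJ hζ hζc i
  have hint : IntegrableOn (fun x => ∑ i : Fin 3, ‖(G x + ((fderiv ℝ (fun x => Real.sin (t * ζ x)) x).smulRight (J (U x)) +
        Real.sin (t * ζ x) • J.comp (G x)) +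
        ((fderiv ℝ (fun x => Real.cos (t * ζ x) - 1) x).smulRight (P (U x)) + (Real.cos (t * ζ x) - 1) • P.comp (G x)))
          (EuclideanSpace.single i (1:ℝ))‖ ^ 2) (Ω : Set _) volume := by
    rw [funext hdens]
    refine (hGi.add (Integrable.const_mul ?_ t)).add (Integrable.const_mul (integrable_finsetSum _ fun i _ => I2 i) (t ^ 2))
    have : IntegrableOn (fun x => ∑ i : Fin 3, fderiv ℝ ζ x (EuclideanSpace.single i (1:ℝ)) *
        ⟪G x (EuclideanSpace.single i (1:ℝ)), J (U x)⟫) (Ω : Set _) volume := integrable_finsetSum _ fun i _ => I1 i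
    exact this.const_mul 2
  exact ⟨_, _, hW, hunit, hint, hzero, hdens⟩

/-- ★★★ **BALL MINIMISERS INTO A SPHERE ARE WEAKLY HARMONIC (conservation-law form).**  Let `U` be weakly differentiable on
the open `Ω ⊆ ℝ³` with weak gradient `G` (lit `HasWeakFDerivOn Ω volume U G`), unit on `Ω`, of finite energy
`∫_Ω Σ_i‖G e_i‖² < ∞`, and energy minimising on the ball `B_ρ(y) ⊆ Ω` among finite-energy unit `W^{1,2}(Ω)` competitors that
agree with `U` off some `B_{ρ″}(y)`, `ρ″ < ρ` ([Simon1996, §2.1] in Sobolev phrasing; the `hmin` row of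
✓`PoincareLipschitzAxialStationarity.axial_stationarity` VERBATIM).  Then for every orthonormal pair `p, q ∈ F` and every
`ζ ∈ C^∞` with `tsupport ζ ⊆ B_{ρ′}(y)`, `ρ′ < ρ`:
`∫_{B_ρ(y)} Σ_i ∂_iζ · ( ⟪p, U⟫·⟪G e_i, q⟫ − ⟪q, U⟫·⟪G e_i, p⟫ ) = 0`
— the weak form of `div(U^p ∇U^q − U^q ∇U^p) = 0`, i.e. (over all `p ⊥ q`) the harmonic-map equation `−ΔU = |∇U|²U` for
sphere-valued maps in divergence form.  Proof: the rotated competitor ★★ `exists_rotated_competitor`, exact quadratic expansion in `t`, minimality for `t` of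
both signs. [cite: Helein2002, §1.4; Simon1996, §2.2 (ii); SchoenUhlenbeck1982, §2] -/
theorem weaklyHarmonic {Ω : Opens (EuclideanSpace ℝ (Fin 3))}
    {U : EuclideanSpace ℝ (Fin 3) → F} {G : EuclideanSpace ℝ (Fin 3) → EuclideanSpace ℝ (Fin 3) →L[ℝ] F}
    (hU : HasWeakFDerivOn Ω volume U G) (hU1 : ∀ x ∈ (Ω : Set (EuclideanSpace ℝ (Fin 3))), ‖U x‖ = 1)
    (hGi : IntegrableOn (fun x => ∑ i : Fin 3, ‖G x (EuclideanSpace.single i (1:ℝ))‖ ^ 2) (Ω : Set _) volume)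
    {y : EuclideanSpace ℝ (Fin 3)} {ρ ρ' : ℝ} (hρ' : ρ' < ρ) (hB : ball y ρ ⊆ (Ω : Set _))
    (hmin : ∀ (W : EuclideanSpace ℝ (Fin 3) → F) (GW : EuclideanSpace ℝ (Fin 3) → EuclideanSpace ℝ (Fin 3) →L[ℝ] F),
      HasWeakFDerivOn Ω volume W GW → (∀ x ∈ (Ω : Set (EuclideanSpace ℝ (Fin 3))), ‖W x‖ = 1) →
      IntegrableOn (fun x => ∑ i : Fin 3, ‖GW x (EuclideanSpace.single i (1:ℝ))‖ ^ 2) (Ω : Set _) volume →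
      (∃ ρ'' : ℝ, ρ'' < ρ ∧ ∀ x, x ∉ ball y ρ'' → W x = U x) →
      ∫ x in ball y ρ, ∑ i : Fin 3, ‖G x (EuclideanSpace.single i (1:ℝ))‖ ^ 2 ≤
        ∫ x in ball y ρ, ∑ i : Fin 3, ‖GW x (EuclideanSpace.single i (1:ℝ))‖ ^ 2)
    {p q : F} (hp : ‖p‖ = 1) (hq : ‖q‖ = 1) (hpq : ⟪p, q⟫ = 0)
    {ζ : EuclideanSpace ℝ (Fin 3) → ℝ} (hζ : ContDiff ℝ ∞ ζ) (hζs : tsupport ζ ⊆ ball y ρ') :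
    ∫ x in ball y ρ, ∑ i : Fin 3, fderiv ℝ ζ x (EuclideanSpace.single i (1:ℝ)) *
      (⟪p, U x⟫ * ⟪G x (EuclideanSpace.single i (1:ℝ)), q⟫ - ⟪q, U x⟫ * ⟪G x (EuclideanSpace.single i (1:ℝ)), p⟫) = 0 := by
  -- the plane maps `J`, `P` as continuous linear maps
  set J : F →L[ℝ] F := (innerSL ℝ p).smulRight q - (innerSL ℝ q).smulRight p with hJdef
  set P : F →L[ℝ] F := (innerSL ℝ p).smulRight p + (innerSL ℝ q).smulRight q with hPdef
  have hJ : ∀ z, J z = ⟪p, z⟫ • q - ⟪q, z⟫ • p := fun z => by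
    simp only [hJdef, sub_apply, ContinuousLinearMap.smulRight_apply, innerSL_apply_apply]
  have hP : ∀ z, P z = ⟪p, z⟫ • p + ⟪q, z⟫ • q := fun z => by
    simp only [hPdef, add_apply, ContinuousLinearMap.smulRight_apply, innerSL_apply_apply]
  -- the integrand is `Σ_i ∂_iζ ⟪G e_i, J U⟫`
  have hI : (fun x => ∑ i : Fin 3, fderiv ℝ ζ x (EuclideanSpace.single i (1:ℝ)) *
      (⟪p, U x⟫ * ⟪G x (EuclideanSpace.single i (1:ℝ)), q⟫ - ⟪q, U x⟫ * ⟪G x (EuclideanSpace.single i (1:ℝ)), p⟫)) =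
      fun x => ∑ i : Fin 3, fderiv ℝ ζ x (EuclideanSpace.single i (1:ℝ)) * ⟪G x (EuclideanSpace.single i (1:ℝ)), J (U x)⟫ := by
    funext x
    refine Finset.sum_congr rfl fun i _ => ?_
    rw [hJ, inner_sub_right, real_inner_smul_right, real_inner_smul_right]
  rw [hI]
  -- geometry of the supports
  have hρ'B : ball y ρ' ⊆ ball y ρ := ball_subset_ball hρ'.le
  have hζc : HasCompactSupport ζ :=
    IsCompact.of_isClosed_subset (isCompact_closedBall y ρ') (isClosed_tsupport ζ) (hζs.trans ball_subset_closedBall)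
  have hBm : MeasurableSet (ball y ρ) := measurableSet_ball
  -- the two integrals of the expansion
  set I₁ : ℝ := ∫ x in ball y ρ, ∑ i : Fin 3, fderiv ℝ ζ x (EuclideanSpace.single i (1:ℝ)) *
      ⟪G x (EuclideanSpace.single i (1:ℝ)), J (U x)⟫ with hI₁
  set I₂ : ℝ := ∫ x in ball y ρ, ∑ i : Fin 3, fderiv ℝ ζ x (EuclideanSpace.single i (1:ℝ)) ^ 2 * ‖J (U x)‖ ^ 2 with hI₂
  have hI₂0 : 0 ≤ I₂ :=
    setIntegral_nonneg hBm fun x _ => Finset.sum_nonneg fun i _ => mul_nonneg (sq_nonneg _) (sq_nonneg _)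
  -- `2 I₁ = 0` from `0 ≤ t (2 I₁) + t² I₂` for all `|t| ≤ 1`
  suffices h2 : 2 * I₁ = 0 by linarith
  refine eq_zero_of_quadratic_nonneg (t₀ := 1) one_pos hI₂0 fun t _ => ?_
  obtain ⟨W, GW, hW, hW1, hWi, hWU, hWE⟩ := exists_rotated_competitor hU hU1 hGi hp hq hpq hJ hP hζ hζc t
  -- minimality applied to the rotated competitor
  have hminW := hmin W GW hW hW1 hWi
    ⟨ρ', hρ', fun x hx => hWU x (image_eq_zero_of_notMem_tsupport fun h => hx (hζs h))⟩
  rw [funext hWE] at hminW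
  -- split the integral of the expanded density
  have hGiB : IntegrableOn (fun x => ∑ i : Fin 3, ‖G x (EuclideanSpace.single i (1:ℝ))‖ ^ 2) (ball y ρ) volume :=
    hGi.mono_set hB
  -- the two correction terms are integrable on the ball
  have IS₁Ω : IntegrableOn (fun x => ∑ i : Fin 3, fderiv ℝ ζ x (EuclideanSpace.single i (1:ℝ)) *
      ⟪G x (EuclideanSpace.single i (1:ℝ)), J (U x)⟫) (Ω : Set _) volume :=
    integrable_finsetSum _ fun i _ => integrableOn_cross_term hU hU1 hGi hp hq hpq hJ hζ hζc i
  have IS₂Ω : IntegrableOn (fun x => ∑ i : Fin 3, fderiv ℝ ζ x (EuclideanSpace.single i (1:ℝ)) ^ 2 * ‖J (U x)‖ ^ 2)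
      (Ω : Set _) volume :=
    integrable_finsetSum _ fun i _ => integrableOn_quad_term hU hU1 hp hq hpq hJ hζ hζc i
  have hT1 : IntegrableOn (fun x => t * (2 * ∑ i : Fin 3, fderiv ℝ ζ x (EuclideanSpace.single i (1:ℝ)) *
      ⟪G x (EuclideanSpace.single i (1:ℝ)), J (U x)⟫)) (ball y ρ) volume :=
    ((IS₁Ω.mono_set hB).const_mul 2).const_mul t
  have hT2 : IntegrableOn (fun x => t ^ 2 * ∑ i : Fin 3, fderiv ℝ ζ x (EuclideanSpace.single i (1:ℝ)) ^ 2 * ‖J (U x)‖ ^ 2)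
      (ball y ρ) volume := (IS₂Ω.mono_set hB).const_mul (t ^ 2)
  have hAT1 : IntegrableOn (fun x => (∑ i : Fin 3, ‖G x (EuclideanSpace.single i (1:ℝ))‖ ^ 2) +
      t * (2 * ∑ i : Fin 3, fderiv ℝ ζ x (EuclideanSpace.single i (1:ℝ)) *
        ⟪G x (EuclideanSpace.single i (1:ℝ)), J (U x)⟫)) (ball y ρ) volume := hGiB.add hT1
  rw [integral_add hAT1 hT2, integral_add hGiB hT1, integral_const_mul, integral_const_mul, integral_const_mul] at hminW
  linarith

/-! ## §2 The same on the open unit cube, in the letters of the vended facts `MinimisingMapSmoothness` ∕ `…Compactness` -/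

/-- ★★★ **EVERY MAP IN THE CLASS OF THE VENDED FACTS IS WEAKLY HARMONIC.**  Let `(U, G)` satisfy the hypothesis block of
lit `Literature.Analysis.PDE.MinimisingMapSmoothness` VERBATIM (weakly differentiable on the open unit cube `Q ⊂ ℝ³`, unit
on `Q`, of finite energy on `Q`, minimising on every ball `B̄_ρ(y) ⊆ Q` against finite-energy unit competitors agreeing with
`U` off a smaller concentric ball).  Then for every such ball, every `ρ′ < ρ`, every orthonormal pair `p, q ∈ ℝ⁴` and every
`ζ ∈ C^∞` with `tsupport ζ ⊆ B_{ρ′}(y)`: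
`∫_{B_ρ(y)} Σ_i ∂_iζ · ( ⟪p, U⟫·⟪G e_i, q⟫ − ⟪q, U⟫·⟪G e_i, p⟫ ) = 0` — the weak harmonic-map equation (conservation-law
form) of the maps whose `C^∞` regularity the named fact (RS) asserts. [cite: Helein2002, §1.4; SchoenUhlenbeck1984, §1; Simon1996, §2.2 (ii)] -/
theorem weaklyHarmonic_of_cubeMinimiser
    (hQ : IsOpen {x : EuclideanSpace ℝ (Fin 3) | ∀ i : Fin 3, |x i| < 1})
    {U : EuclideanSpace ℝ (Fin 3) → EuclideanSpace ℝ (Fin 4)}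
    {G : EuclideanSpace ℝ (Fin 3) → (EuclideanSpace ℝ (Fin 3) →L[ℝ] EuclideanSpace ℝ (Fin 4))}
    (hUG : HasWeakFDerivOn ⟨{x : EuclideanSpace ℝ (Fin 3) | ∀ i : Fin 3, |x i| < 1}, hQ⟩ volume U G ∧
        (∀ x : EuclideanSpace ℝ (Fin 3), (∀ i : Fin 3, |x i| < 1) → ‖U x‖ = 1) ∧
        IntegrableOn (fun x => ∑ i : Fin 3, ‖G x (EuclideanSpace.single i (1:ℝ))‖ ^ 2) {x : EuclideanSpace ℝ (Fin 3) | ∀ i : Fin 3, |x i| < 1} ∧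
        (∀ (y : EuclideanSpace ℝ (Fin 3)) (ρ : ℝ), 0 < ρ → closedBall y ρ ⊆ {x : EuclideanSpace ℝ (Fin 3) | ∀ i : Fin 3, |x i| < 1} →
          ∀ (W : EuclideanSpace ℝ (Fin 3) → EuclideanSpace ℝ (Fin 4)) (GW : EuclideanSpace ℝ (Fin 3) → (EuclideanSpace ℝ (Fin 3) →L[ℝ] EuclideanSpace ℝ (Fin 4))),
          HasWeakFDerivOn ⟨{x : EuclideanSpace ℝ (Fin 3) | ∀ i : Fin 3, |x i| < 1}, hQ⟩ volume W GW →
          (∀ x : EuclideanSpace ℝ (Fin 3), (∀ i : Fin 3, |x i| < 1) → ‖W x‖ = 1) →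
          IntegrableOn (fun x => ∑ i : Fin 3, ‖GW x (EuclideanSpace.single i (1:ℝ))‖ ^ 2) {x : EuclideanSpace ℝ (Fin 3) | ∀ i : Fin 3, |x i| < 1} →
          (∃ ρ' : ℝ, ρ' < ρ ∧ ∀ x : EuclideanSpace ℝ (Fin 3), x ∉ ball y ρ' → W x = U x) →
          ∫ x in ball y ρ, ∑ i : Fin 3, ‖G x (EuclideanSpace.single i (1:ℝ))‖ ^ 2 ≤ ∫ x in ball y ρ, ∑ i : Fin 3, ‖GW x (EuclideanSpace.single i (1:ℝ))‖ ^ 2))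
    {y : EuclideanSpace ℝ (Fin 3)} {ρ ρ' : ℝ} (hρ : 0 < ρ)
    (hyQ : closedBall y ρ ⊆ {x : EuclideanSpace ℝ (Fin 3) | ∀ i : Fin 3, |x i| < 1}) (hρ' : ρ' < ρ)
    {p q : EuclideanSpace ℝ (Fin 4)} (hp : ‖p‖ = 1) (hq : ‖q‖ = 1) (hpq : ⟪p, q⟫ = 0)
    {ζ : EuclideanSpace ℝ (Fin 3) → ℝ} (hζ : ContDiff ℝ ∞ ζ) (hζs : tsupport ζ ⊆ ball y ρ') :
    ∫ x in ball y ρ, ∑ i : Fin 3, fderiv ℝ ζ x (EuclideanSpace.single i (1:ℝ)) *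
      (⟪p, U x⟫ * ⟪G x (EuclideanSpace.single i (1:ℝ)), q⟫ - ⟪q, U x⟫ * ⟪G x (EuclideanSpace.single i (1:ℝ)), p⟫) = 0 := by
  obtain ⟨hU, hU1, hGi, hmin⟩ := hUG
  exact weaklyHarmonic (Ω := ⟨{x : EuclideanSpace ℝ (Fin 3) | ∀ i : Fin 3, |x i| < 1}, hQ⟩) hU
    (fun x hx => hU1 x hx) hGi hρ' (ball_subset_closedBall.trans hyQ)
    (fun W GW hW hW1 hWi hWU => hmin y ρ hρ hyQ W GW hW (fun x hx => hW1 x hx) hWi hWU) hp hq hpq hζ hζs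

end Summit.QuantumFields.YangMills.Theorems.PoincareLipschitzMinimiserWeaklyHarmonic

end
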